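import Mathlib
import Summits.Ventures.DiscreteObjects.Mahler.CensusSearchCuts

/-!
# Packed (Kronecker) Newton steps for the kernel census search (venture `DiscreteObjects`, target L)

Cell `pub-namedobj`, seat `pub-namedobj-mahler-g20` (pipeline of seats g12–g19). Framing: lottery ticket; floor = certified
bounds/negative ranges.

The leaf test of the census search (`leafPass`, mahler g13: Newton steps `P_k = -k c_k - Σ_{i<k} c_i P_{k-i}` against the
thresholds `|P_k| ≤ T_k`) is re-implemented on PACKED naturals: the coefficients `c_1,…,c_{2d}` and the power sums
`P_1,…,P_{k-1}` are stored as two's-complement 64-bit digits (`enc`) in the slots of base-`γ = 2^192` naturals, so that ONE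
kernel big-integer multiplication computes every dot product `Σ c_i P_{k-i}` at once (slot `k` of `C·S`, read modulo
`W = 2^64`), and the term `k c_k` is a third packed summand `D`.  Only the kernel-accelerated `Nat` primitives are used and no
`match` is ever performed on a big literal (measured: ≈ 0.13 ms per Newton step against ≈ 2.8 ms for the list form; see the
seat's STATUS).  Soundness is a TRANSFER: if the list test `leafPass cs ts prev` passes then the packed loop `leafLoopP` passes
on any state encoding `(cs, prev)` (`leafLoopP_of_leafPass`); the proof reads slot `k` of `C·S + D` through ghost polynomials
over `ℕ` (`cPoly`, `sPoly`, `dPoly`: the slot is the `k`-th coefficient of the product, `eval_div_pow_mod`, and that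
coefficient is `-P_k` modulo `W`, `coeff_ghost_k`).  Infrastructure only; no census row is claimed here.
-/

namespace Summit.Ventures.DiscreteObjects.Mahler

open Polynomial

/-! ## Constants, digits, the packed loop -/

/-- Digit modulus `W = 2^64`. -/
def pW : ℕ := 18446744073709551616

/-- `2W`. -/
def pW2 : ℕ := 36893488147419103232

/-- Slot base `γ = 2^192`. -/
def pG : ℕ := 6277101735386680763835789423207666416102355444464034512896

/-- Two's-complement 64-bit digit of an integer. -/
def enc (x : ℤ) : ℕ := (x % (18446744073709551616 : ℤ)).toNat

/-- **The packed leaf loop**: thresholds `ts`, state `Z = C·S + D`, slot multiplier `g = γ^k`; one Newton step = read slot `k`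
(`≡ -P_k (mod W)`), test `|P_k| ≤ t` as `((2W - slot) + t) mod W ≤ 2t`, append the digit `2W - slot` to `S`. -/
def leafLoopP (cf : ℕ) : List ℕ → ℕ → ℕ → Bool
  | [], _, _ => true
  | t :: ts, Z, g =>
    let a := pW2 - Z / g % pW
    decide ((a + t) % pW ≤ 2 * t) && leafLoopP cf ts (Z + a * g * cf) (g * pG)

/-- `Σ_i enc(l_i)·γ^(s+i)` (coefficients packed from slot `s`). -/
def packFrom (s : ℕ) : List ℤ → ℕ
  | [] => 0
  | x :: l => enc x * pG ^ s + packFrom (s + 1) l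

/-- `Σ_i enc((s+i)·l_i)·γ^(s+i)` (the terms `k·c_k`, packed from slot `s`). -/
def packFromD (s : ℕ) : List ℤ → ℕ
  | [] => 0
  | x :: l => enc ((s : ℤ) * x) * pG ^ s + packFromD (s + 1) l

/-- Power sums `[P_n,…,P_1]` packed as `Σ_j enc(P_j)·γ^j`. -/
def packS : List ℤ → ℕ
  | [] => 0
  | p :: ps => enc p * pG ^ (ps.length + 1) + packS ps

/-- `γ = W · 2^128`. -/
theorem pG_eq : pG = pW * 2 ^ 128 := by norm_num [pG, pW]

/-- `0 < W`. -/
theorem pW_pos : 0 < pW := by norm_num [pW]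

/-- `0 < γ`. -/
theorem pG_pos : 0 < pG := by norm_num [pG]

/-- Digits are `< W`. -/
theorem enc_lt (x : ℤ) : enc x < pW := by
  have h : x % (18446744073709551616 : ℤ) < 18446744073709551616 := Int.emod_lt_of_pos x (by norm_num)
  have h0 : 0 ≤ x % (18446744073709551616 : ℤ) := Int.emod_nonneg x (by norm_num)
  unfold enc pW
  omega

/-- The digit is the residue. -/
theorem cast_enc (x : ℤ) : ((enc x : ℕ) : ZMod pW) = ((x : ℤ) : ZMod pW) := by
  have h0 : 0 ≤ x % (18446744073709551616 : ℤ) := Int.emod_nonneg x (by norm_num)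
  have h1 : ((enc x : ℕ) : ℤ) = x % (pW : ℕ) := by
    unfold enc pW; push_cast; exact Int.toNat_of_nonneg h0
  rw [← Int.cast_natCast, h1, ZMod.intCast_mod]

/-! ## Ghost polynomials and their coefficients -/

/-- Ghost: `Σ_i enc(cs_i) X^(i+1)`. -/
noncomputable def cPoly (cs : List ℤ) : ℕ[X] :=
  ∑ i ∈ Finset.range cs.length, C (enc (cs.getD i 0)) * X ^ (i + 1)

/-- Ghost: `Σ_{lo ≤ i ≤ |cs|} enc(i·cs_{i-1}) X^i`. -/
noncomputable def dPoly (cs : List ℤ) (lo : ℕ) : ℕ[X] :=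
  ∑ i ∈ Finset.Ico lo (cs.length + 1), C (enc ((i : ℤ) * cs.getD (i - 1) 0)) * X ^ i

/-- Ghost: `Σ_{j<k} σ_j X^j`. -/
noncomputable def sPoly (σ : ℕ → ℕ) (k : ℕ) : ℕ[X] := ∑ j ∈ Finset.range k, C (σ j) * X ^ j

/-- Coefficients of `cPoly`. -/
theorem coeff_cPoly (cs : List ℤ) (m : ℕ) : (cPoly cs).coeff m = if m = 0 then 0 else enc (cs.getD (m - 1) 0) := by
  unfold cPoly
  rw [finsetSum_coeff]
  simp only [coeff_C_mul_X_pow]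
  split_ifs with hm
  · subst hm
    exact Finset.sum_eq_zero fun i _ => by simp
  · rw [Finset.sum_eq_single (m - 1)]
    · rw [if_pos (by omega)]
    · intro i _ hi
      rw [if_neg (by omega)]
    · intro hi
      rw [Finset.mem_range, not_lt] at hi
      rw [List.getD_eq_getElem?_getD, List.getElem?_eq_none_iff.mpr hi, Option.getD_none]
      simp [enc]

/-- Coefficients of `dPoly`. -/
theorem coeff_dPoly (cs : List ℤ) (lo m : ℕ) :
    (dPoly cs lo).coeff m = if lo ≤ m then enc ((m : ℤ) * cs.getD (m - 1) 0) else 0 := by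
  unfold dPoly
  rw [finsetSum_coeff]
  simp only [coeff_C_mul_X_pow]
  split_ifs with hm
  · rw [Finset.sum_eq_single m]
    · simp
    · intro i _ hi
      simp [show m ≠ i by omega]
    · intro hi
      rw [Finset.mem_Ico, not_and_or, not_lt] at hi
      rcases hi with hi | hi
      · exact absurd hm hi
      · simp [List.getD_eq_getElem?_getD, List.getElem?_eq_none_iff.mpr (by omega : cs.length ≤ m - 1), enc]
  · exact Finset.sum_eq_zero fun i hi => by
      rw [Finset.mem_Ico] at hi
      simp [show m ≠ i by omega]

/-- Coefficients of `sPoly`. -/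
theorem coeff_sPoly (σ : ℕ → ℕ) (k m : ℕ) : (sPoly σ k).coeff m = if m < k then σ m else 0 := by
  unfold sPoly
  rw [finsetSum_coeff]
  simp only [coeff_C_mul_X_pow]
  split_ifs with hm
  · rw [Finset.sum_eq_single m]
    · simp
    · intro i _ hi; simp [show m ≠ i by omega]
    · intro hi; rw [Finset.mem_range] at hi; exact absurd hm hi
  · exact Finset.sum_eq_zero fun i hi => by
      rw [Finset.mem_range] at hi
      simp [show m ≠ i by omega]

/-- Appending the digit `a` at slot `k`. -/
theorem sPoly_succ (σ : ℕ → ℕ) (k a : ℕ) : sPoly (Function.update σ k a) (k + 1) = sPoly σ k + C a * X ^ k := by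
  unfold sPoly
  rw [Finset.sum_range_succ, Function.update_self]
  congr 1
  exact Finset.sum_congr rfl fun j hj => by
    rw [Finset.mem_range] at hj
    rw [Function.update_of_ne (by omega)]

/-! ## Reading a slot -/

/-- Digits below `γ` do not reach slot `k`. -/
theorem sum_mul_pow_lt (f : ℕ → ℕ) (k : ℕ) (h : ∀ i < k, f i < pG) : ∑ i ∈ Finset.range k, f i * pG ^ i < pG ^ k := by
  induction k with
  | zero => simp
  | succ k ih =>
    rw [Finset.sum_range_succ, pow_succ]
    have h1 := ih (fun i hi => h i (by omega))
    have h2 : f k + 1 ≤ pG := h k (by omega)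
    have h3 : (f k + 1) * pG ^ k ≤ pG * pG ^ k := Nat.mul_le_mul_right _ h2
    nlinarith

/-- **Slot extraction.** If the coefficients below `k` are `< γ`, slot `k` of `p(γ)` read modulo `W` is `coeff k mod W`. -/
theorem eval_div_pow_mod (p : ℕ[X]) (k : ℕ) (hlow : ∀ m < k, p.coeff m < pG) :
    p.eval pG / pG ^ k % pW = p.coeff k % pW := by
  have hdeg : p.natDegree < p.natDegree + k + 2 := by omega
  rw [Polynomial.eval_eq_sum_range' hdeg]
  have hsplit := Finset.sum_Ico_consecutive (fun i => p.coeff i * pG ^ i) (show 0 ≤ k + 1 by omega)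
    (show k + 1 ≤ p.natDegree + k + 2 by omega)
  rw [← Finset.range_eq_Ico, ← Finset.range_eq_Ico] at hsplit
  rw [← hsplit, Finset.sum_range_succ]
  have hhigh : ∑ i ∈ Finset.Ico (k + 1) (p.natDegree + k + 2), p.coeff i * pG ^ i =
      pG ^ k * (pG * ∑ i ∈ Finset.Ico (k + 1) (p.natDegree + k + 2), p.coeff i * pG ^ (i - (k + 1))) := by
    rw [Finset.mul_sum, Finset.mul_sum]
    refine Finset.sum_congr rfl fun i hi => ?_
    rw [Finset.mem_Ico] at hi
    have : pG ^ i = pG ^ k * (pG * pG ^ (i - (k + 1))) := by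
      rw [← pow_succ', ← pow_add]; congr 1; omega
    rw [this]; ring
  rw [hhigh]
  have hlowlt := sum_mul_pow_lt (fun i => p.coeff i) k hlow
  rw [show ∑ i ∈ Finset.range k, p.coeff i * pG ^ i + p.coeff k * pG ^ k +
      pG ^ k * (pG * ∑ i ∈ Finset.Ico (k + 1) (p.natDegree + k + 2), p.coeff i * pG ^ (i - (k + 1))) =
      ∑ i ∈ Finset.range k, p.coeff i * pG ^ i +
        pG ^ k * (p.coeff k + pG * ∑ i ∈ Finset.Ico (k + 1) (p.natDegree + k + 2), p.coeff i * pG ^ (i - (k + 1)))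
      by ring]
  rw [Nat.add_mul_div_left _ _ (pow_pos pG_pos k), Nat.div_eq_of_lt hlowlt, zero_add, pG_eq,
    show pW * 2 ^ 128 * ∑ i ∈ Finset.Ico (k + 1) (p.natDegree + k + 2), p.coeff i * (pW * 2 ^ 128) ^ (i - (k + 1)) =
      pW * (2 ^ 128 * ∑ i ∈ Finset.Ico (k + 1) (p.natDegree + k + 2), p.coeff i * (pW * 2 ^ 128) ^ (i - (k + 1))) by ring,
    Nat.add_mul_mod_self_left]

/-- The ghost's coefficients below slot `64` are `< γ` whenever the power-sum digits are `< 4W`. -/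
theorem coeff_ghost_lt (cs : List ℤ) (σ : ℕ → ℕ) (k lo m : ℕ) (hσ : ∀ j, σ j < 4 * pW) (hm : m < 64) :
    (cPoly cs * sPoly σ k + dPoly cs lo).coeff m < pG := by
  rw [coeff_add, coeff_mul]
  have h1 : ∑ x ∈ Finset.HasAntidiagonal.antidiagonal m, (cPoly cs).coeff x.1 * (sPoly σ k).coeff x.2 ≤
      (Finset.HasAntidiagonal.antidiagonal m).card • (pW * (4 * pW)) := by
    apply Finset.sum_le_card_nsmul
    intro x _
    have ha : (cPoly cs).coeff x.1 ≤ pW := by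
      rw [coeff_cPoly]; split_ifs
      · exact Nat.zero_le _
      · exact (enc_lt _).le
    have hb : (sPoly σ k).coeff x.2 ≤ 4 * pW := by
      rw [coeff_sPoly]; split_ifs
      · exact (hσ _).le
      · exact Nat.zero_le _
    exact Nat.mul_le_mul ha hb
  rw [Finset.Nat.card_antidiagonal, smul_eq_mul] at h1
  have h2 : (dPoly cs lo).coeff m ≤ pW := by
    rw [coeff_dPoly]; split_ifs
    · exact (enc_lt _).le
    · exact Nat.zero_le _
  have h3 : (m + 1) * (pW * (4 * pW)) ≤ 64 * (pW * (4 * pW)) := Nat.mul_le_mul_right _ (by omega)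
  have h4 : 64 * (pW * (4 * pW)) + pW < pG := by norm_num [pW, pG]
  omega

/-- **Slot `k` of the ghost is `-P_k` modulo `W`** (`P_k = newtonNext cs prev`, `|prev| = k - 1`, digits `σ` congruent to `prev`). -/
theorem coeff_ghost_k (cs prev : List ℤ) (σ : ℕ → ℕ) (k lo : ℕ) (hk : prev.length + 1 = k) (hσ0 : σ 0 = 0)
    (hσ : ∀ i < prev.length, ((σ (k - 1 - i) : ℕ) : ZMod pW) = ((prev.getD i 0 : ℤ) : ZMod pW)) (hlo : lo ≤ k) :
    (((cPoly cs * sPoly σ k + dPoly cs lo).coeff k : ℕ) : ZMod pW) = -((newtonNext cs prev : ℤ) : ZMod pW) := by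
  rw [coeff_add, coeff_mul,
    Finset.Nat.sum_antidiagonal_eq_sum_range_succ (fun i j : ℕ => ((cPoly cs).coeff i * (sPoly σ k).coeff j : ℕ)) k,
    Finset.sum_range_succ', coeff_dPoly, if_pos hlo, newtonNext, sum_zipWith_mul_eq]
  simp only [coeff_cPoly, coeff_sPoly, if_true, zero_mul, add_zero, Nat.add_sub_cancel,
    show ∀ i : ℕ, (i + 1 = 0) = False from fun i => by simp]
  simp only [if_false]
  rw [← hk, Finset.sum_range_succ]
  simp only [show prev.length + 1 - (prev.length + 1) = 0 by omega, hσ0, ite_self, mul_zero,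
    add_zero, Nat.add_sub_cancel]
  have hite : ∀ x ∈ Finset.range prev.length,
      enc (cs.getD x 0) * (if prev.length + 1 - (x + 1) < prev.length + 1 then σ (prev.length + 1 - (x + 1)) else 0) =
        enc (cs.getD x 0) * σ (prev.length - x) := by
    intro x hx
    rw [Finset.mem_range] at hx
    rw [if_pos (by omega), show prev.length + 1 - (x + 1) = prev.length - x by omega]
  rw [Finset.sum_congr rfl hite]
  push_cast
  simp only [cast_enc]
  have hσ' : ∀ i ∈ Finset.range prev.length, ((cs.getD i 0 : ℤ) : ZMod pW) * ((σ (prev.length - i) : ℕ) : ZMod pW) =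
      ((cs.getD i 0 : ℤ) : ZMod pW) * ((prev.getD i 0 : ℤ) : ZMod pW) := by
    intro i hi
    rw [Finset.mem_range] at hi
    have := hσ i hi
    rw [show k - 1 - i = prev.length - i by omega] at this
    rw [this]
  rw [Finset.sum_congr rfl hσ']
  push_cast
  ring

/-- **The packed test passes when `|P_k| ≤ t`.** -/
theorem packedTest_of_abs_le (m t : ℕ) (p : ℤ) (hm : m < pW) (hmod : ((m : ℕ) : ZMod pW) = -((p : ℤ) : ZMod pW))
    (hp : p.natAbs ≤ t) (ht : t < 2 ^ 61) : (pW2 - m + t) % pW ≤ 2 * t := by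
  have hW2 : pW2 = 2 * pW := by norm_num [pW, pW2]
  have hcast : (((pW2 - m + t : ℕ) : ℤ) : ZMod pW) = ((p + t : ℤ) : ZMod pW) := by
    have : (((pW2 - m + t : ℕ) : ℤ) : ZMod pW) = ((pW2 : ℕ) : ZMod pW) - ((m : ℕ) : ZMod pW) + ((t : ℕ) : ZMod pW) := by
      push_cast [Nat.cast_sub (show m ≤ pW2 by omega)]; ring
    rw [this, hmod, hW2]
    push_cast
    rw [ZMod.natCast_self]
    ring
  rw [ZMod.intCast_eq_intCast_iff] at hcast
  have h1 : ((pW2 - m + t : ℕ) : ℤ) % (pW : ℕ) = (p + t) % (pW : ℕ) := hcast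
  have h2 : (p + (t : ℤ)) % (pW : ℕ) = p + t := by
    apply Int.emod_eq_of_lt
    · omega
    · unfold pW; push_cast; omega
  have h3 : (((pW2 - m + t) % pW : ℕ) : ℤ) = p + t := by rw [Int.natCast_mod, h1, h2]
  omega

/-! ## Transfer: the packed loop passes whenever the list test passes -/

/-- **Transfer for the leaf test.** If `leafPass cs ts prev = true` and `(Z, g)` encodes `(cs, prev)` (slot multiplier
`g = γ^k`, `k = |prev| + 1`, ghost digits `σ` congruent to `prev` and `< 4W`, `Z = (C·S + D)(γ)`, thresholds `< 2^61`,
at most `64` slots), then `leafLoopP cf ts Z g = true`. -/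
theorem leafLoopP_of_leafPass (cs : List ℤ) (lo cf : ℕ) (hcf : cf = (cPoly cs).eval pG) :
    ∀ (ts : List ℕ) (prev : List ℤ) (σ : ℕ → ℕ) (k Z g : ℕ),
      prev.length + 1 = k → lo ≤ k → k + ts.length ≤ 64 → (∀ t ∈ ts, t < 2 ^ 61) → σ 0 = 0 → (∀ j, σ j < 4 * pW) →
      (∀ i < prev.length, ((σ (k - 1 - i) : ℕ) : ZMod pW) = ((prev.getD i 0 : ℤ) : ZMod pW)) →
      Z = (cPoly cs * sPoly σ k + dPoly cs lo).eval pG → g = pG ^ k →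
      leafPass cs ts prev = true → leafLoopP cf ts Z g = true := by
  intro ts
  induction ts with
  | nil => intros; rfl
  | cons t ts ih =>
    intro prev σ k Z g hk hlo hlen hts hσ0 hσ hσp hZ hg hpass
    rw [leafPass, Bool.and_eq_true, decide_eq_true_eq] at hpass
    obtain ⟨ht, hrest⟩ := hpass
    have hslot : Z / g % pW = (cPoly cs * sPoly σ k + dPoly cs lo).coeff k % pW := by
      rw [hZ, hg]
      exact eval_div_pow_mod _ k fun m hm => coeff_ghost_lt cs σ k lo m hσ (by simp at hlen; omega)
    set m := Z / g % pW with hm_def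
    have hm : m < pW := Nat.mod_lt _ pW_pos
    have hmod : ((m : ℕ) : ZMod pW) = -((newtonNext cs prev : ℤ) : ZMod pW) := by
      rw [hslot, ZMod.natCast_mod, coeff_ghost_k cs prev σ k lo hk hσ0 hσp hlo]
    rw [leafLoopP, Bool.and_eq_true, decide_eq_true_eq]
    refine ⟨packedTest_of_abs_le m t _ hm hmod ht (hts t (by simp)), ?_⟩
    -- the new digit
    set a := pW2 - m with ha_def
    have haW : a < 4 * pW := by simp only [ha_def, pW2, pW]; omega
    have hamod : ((a : ℕ) : ZMod pW) = ((newtonNext cs prev : ℤ) : ZMod pW) := by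
      have : ((a : ℕ) : ZMod pW) = ((pW2 : ℕ) : ZMod pW) - ((m : ℕ) : ZMod pW) := by
        rw [ha_def, Nat.cast_sub (by simp only [pW2, pW] at hm ⊢; omega)]
      rw [this, hmod, show pW2 = 2 * pW by norm_num [pW, pW2]]
      push_cast
      rw [ZMod.natCast_self]; ring
    refine ih (newtonNext cs prev :: prev) (Function.update σ k a) (k + 1) _ _ (by simp [hk]) (by omega)
      (by simp at hlen ⊢; omega) (fun t' ht' => hts t' (by simp [ht'])) ?_ ?_ ?_ ?_ (by rw [hg, pow_succ]) hrest
    · rw [Function.update_of_ne (by omega)]; exact hσ0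
    · intro j
      rcases eq_or_ne j k with rfl | hj
      · rw [Function.update_self]; exact haW
      · rw [Function.update_of_ne hj]; exact hσ j
    · intro i hi
      simp only [List.length_cons] at hi
      cases i with
      | zero =>
        rw [show k + 1 - 1 - 0 = k by omega, Function.update_self, List.getD_cons_zero]
        exact hamod
      | succ i =>
        rw [show k + 1 - 1 - (i + 1) = k - 1 - i by omega, Function.update_of_ne (by omega), List.getD_cons_succ]
        exact hσp i (by omega)
    · rw [hZ, sPoly_succ, hcf]
      simp only [eval_add, eval_mul, eval_C, eval_pow, eval_X, mul_add, hg]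
      ring

end Summit.Ventures.DiscreteObjects.Mahler
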